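import Mathlib
import HarnessLib

/-!
# Four-sector counting, fold ranges: locating the CRITICAL POINT of the diagonal function from a near-critical row

Topic `Literature/MathematicalPhysics/QuantumLattice`; sub-namespace `BandSectorCounting` (generic one-variable calculus, continues the Toolbox).
Part (F3e) of the log-free ANISOTROPIC anchored four-sector counting lemma («E1-P2-THIN-COUNT», cell gate-hubbard-kl, plan g17 (R41); seat p4; plan
HOME/prover-p4/E1-P2-THIN-COUNT-PLAN.md §Refinement 4).  The sharp level count `level_count_near_min_sharp` (`ThinSectorLevelCountNearMin`) is stated at a
nondegenerate minimum `σ_c` of the diagonal function `D`; the two-regime fold sum meets instead ROWS `σ` with a small slope `|D′(σ)| ≤ ε` inside the stratum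
where `D″ ≥ c₂ > 0` (`diag_strat`).  This file locates `σ_c` from such a row — the intermediate value theorem for `D′`, which moves at rate `≥ c₂` — and
records the slope growth away from it (rows farther than `R` from `σ_c` are transversal):

* **`exists_critical_near`** — `c₂ ≤ g″` on `[x₀ − R, x₀ + R]`, `|g′(x₀)| ≤ ε`, `ε ≤ c₂R`: there is `σ_c` with `g′(σ_c) = 0`, `|σ_c − x₀| ≤ ε/c₂`;
* **`abs_deriv_ge_of_critical`** — `c₂ ≤ g″` on `[σ_c − R, σ_c + R]`, `g′(σ_c) = 0`: `c₂·|σ − σ_c| ≤ |g′(σ)|` on that window;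
* **`le_of_critical`** — there `g(σ_c) ≤ g(σ)` (the critical point is the window minimum), indeed `g(σ_c) + (c₂/2)(σ − σ_c)² ≤ g(σ)`.

Everything is PROVED; no definitions, no named facts.

## Sources

* G. Benfatto, A. Giuliani, V. Mastropietro, Ann. Henri Poincaré 7 (2006) 809–898, Lemma 3.1 / App. A2. [BenfattoGiulianiMastropietro2006]
* V. Mastropietro, *Non-Perturbative Renormalization* (World Scientific, 2008), ch. 14, (14.67) p. 223. [Mastropietro2008]
-/

noncomputable section

open Real Set

namespace Literature.MathematicalPhysics.QuantumLattice.BandSectorCounting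

/-- Slope growth to the right under `g″ ≥ c₂`: `c₂ (z − x) ≤ g′ z − g′ x` for `z ∈ [x, y]`. [folklore] -/
private theorem slope_growth_right {g' g'' : ℝ → ℝ} (hg' : ∀ z, HasDerivAt g' (g'' z) z) {x y c₂ : ℝ}
    (h : ∀ z ∈ Icc x y, c₂ ≤ g'' z) {z : ℝ} (hz : z ∈ Icc x y) : c₂ * (z - x) ≤ g' z - g' x := by
  have hd' : ∀ z, HasDerivAt g' (deriv g' z) z := fun z => by rw [(hg' z).deriv]; exact hg' z
  exact (convex_Icc x y).mul_sub_le_image_sub_of_le_deriv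
    (fun t _ => (hd' t).continuousAt.continuousWithinAt)
    (fun t _ => (hd' t).differentiableAt.differentiableWithinAt)
    (fun t ht => by rw [(hg' t).deriv]; exact h t (interior_subset ht)) x
    (left_mem_Icc.2 (hz.1.trans hz.2)) z hz hz.1

/-- Slope growth to the left under `g″ ≥ c₂`: `c₂ (y − z) ≤ g′ y − g′ z` for `z ∈ [x, y]`. [folklore] -/
private theorem slope_growth_left {g' g'' : ℝ → ℝ} (hg' : ∀ z, HasDerivAt g' (g'' z) z) {x y c₂ : ℝ}
    (h : ∀ z ∈ Icc x y, c₂ ≤ g'' z) {z : ℝ} (hz : z ∈ Icc x y) : c₂ * (y - z) ≤ g' y - g' z := by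
  have hd' : ∀ z, HasDerivAt g' (deriv g' z) z := fun z => by rw [(hg' z).deriv]; exact hg' z
  exact (convex_Icc x y).mul_sub_le_image_sub_of_le_deriv
    (fun t _ => (hd' t).continuousAt.continuousWithinAt)
    (fun t _ => (hd' t).differentiableAt.differentiableWithinAt)
    (fun t ht => by rw [(hg' t).deriv]; exact h t (interior_subset ht)) z hz y
    (right_mem_Icc.2 (hz.1.trans hz.2)) hz.2

/-- **Locating the critical point.**  If `c₂ ≤ g″` on `[x₀ − R, x₀ + R]` (`0 < c₂`), `|g′(x₀)| ≤ ε` and `ε ≤ c₂·R`, then `g′` vanishes at some `σ_c` with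
`|σ_c − x₀| ≤ ε/c₂` (intermediate value theorem: `g′` changes by at least `ε` over a distance `ε/c₂`).
[cite: BenfattoGiulianiMastropietro2006, Lemma 3.1 / App. A2] -/
theorem exists_critical_near {g' g'' : ℝ → ℝ} (hg' : ∀ z, HasDerivAt g' (g'' z) z) {x₀ R c₂ ε : ℝ} (hc₂ : 0 < c₂)
    (hlo : ∀ z ∈ Icc (x₀ - R) (x₀ + R), c₂ ≤ g'' z) (hε : |g' x₀| ≤ ε) (hεR : ε ≤ c₂ * R) :
    ∃ σc : ℝ, g' σc = 0 ∧ |σc - x₀| ≤ ε / c₂ := by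
  have hε0 : 0 ≤ ε := (abs_nonneg _).trans hε
  have hr : ε / c₂ ≤ R := by rw [div_le_iff₀ hc₂]; linarith
  have hr0 : 0 ≤ ε / c₂ := div_nonneg hε0 hc₂.le
  have hcont : Continuous g' := continuous_iff_continuousAt.2 fun z => (hg' z).continuousAt
  rcases le_or_gt 0 (g' x₀) with hpos | hneg
  · -- go left: `g′(x₀ − ε/c₂) ≤ g′(x₀) − ε ≤ 0`
    set x₁ := x₀ - ε / c₂ with hx₁
    have hx₁I : x₁ ∈ Icc (x₀ - R) x₀ := ⟨by rw [hx₁]; linarith, by rw [hx₁]; linarith⟩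
    have hgrow := slope_growth_left hg' (x := x₀ - R) (y := x₀) (fun z hz => hlo z ⟨hz.1, by linarith [hz.2, hr, hr0]⟩) hx₁I
    have hg1 : g' x₁ ≤ 0 := by
      have e : c₂ * (x₀ - x₁) = ε := by rw [hx₁]; field_simp; ring
      have := (abs_le.1 hε).2
      linarith
    -- IVT on `[x₁, x₀]`
    have hivt := intermediate_value_Icc (show x₁ ≤ x₀ from hx₁I.2) hcont.continuousOn
    obtain ⟨σc, hσc, hval⟩ := hivt ⟨hg1, hpos⟩
    refine ⟨σc, hval, ?_⟩
    rw [abs_le]; constructor <;> [linarith [hσc.1, hx₁I.1]; linarith [hσc.2]]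
  · -- go right: `g′(x₀ + ε/c₂) ≥ g′(x₀) + ε ≥ 0`
    set x₁ := x₀ + ε / c₂ with hx₁
    have hx₁I : x₁ ∈ Icc x₀ (x₀ + R) := ⟨by rw [hx₁]; linarith, by rw [hx₁]; linarith⟩
    have hgrow := slope_growth_right hg' (x := x₀) (y := x₀ + R) (fun z hz => hlo z ⟨by linarith [hz.1, hr, hr0], hz.2⟩) hx₁I
    have hg1 : 0 ≤ g' x₁ := by
      have e : c₂ * (x₁ - x₀) = ε := by rw [hx₁]; field_simp; ring
      have := (abs_le.1 hε).1
      linarith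
    have hivt := intermediate_value_Icc (show x₀ ≤ x₁ from hx₁I.1) hcont.continuousOn
    obtain ⟨σc, hσc, hval⟩ := hivt ⟨hneg.le, hg1⟩
    refine ⟨σc, hval, ?_⟩
    rw [abs_le]; constructor <;> [linarith [hσc.1]; linarith [hσc.2, hx₁I.2]]

/-- **Slope growth away from the critical point**: with `c₂ ≤ g″` on `[σ_c − R, σ_c + R]` and `g′(σ_c) = 0`, `c₂·|σ − σ_c| ≤ |g′(σ)|` on the window
(so rows farther than `2λ/c₂` from `σ_c` are transversal, `|D′| ≥ 2λ`). [cite: BenfattoGiulianiMastropietro2006, Lemma 3.1 / App. A2] -/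
theorem abs_deriv_ge_of_critical {g' g'' : ℝ → ℝ} (hg' : ∀ z, HasDerivAt g' (g'' z) z) {σc R c₂ : ℝ}
    (hlo : ∀ z ∈ Icc (σc - R) (σc + R), c₂ ≤ g'' z) (hcrit : g' σc = 0) {σ : ℝ} (hσ : σ ∈ Icc (σc - R) (σc + R)) :
    c₂ * |σ - σc| ≤ |g' σ| := by
  rcases le_total σc σ with hle | hle
  · have := slope_growth_right hg' (x := σc) (y := σc + R) (fun u hu => hlo u ⟨by linarith [hu.1, hσ.1, hσ.2], hu.2⟩) ⟨hle, hσ.2⟩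
    rw [hcrit, sub_zero] at this
    rw [abs_of_nonneg (sub_nonneg.2 hle)]
    exact this.trans (le_abs_self _)
  · have := slope_growth_left hg' (x := σc - R) (y := σc) (fun u hu => hlo u ⟨hu.1, by linarith [hu.2, hσ.1, hσ.2]⟩) ⟨hσ.1, hle⟩
    rw [hcrit, zero_sub] at this
    rw [abs_of_nonpos (sub_nonpos.2 hle), neg_sub]
    exact this.trans (by rw [← abs_neg]; exact le_abs_self _)

/-- **The critical point is the window minimum**, quantitatively: `g(σ_c) + (c₂/2)(σ − σ_c)² ≤ g(σ)` on the window.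
[cite: BenfattoGiulianiMastropietro2006, Lemma 3.1 / App. A2] -/
theorem le_of_critical {g g' g'' : ℝ → ℝ} (hg : ∀ z, HasDerivAt g (g' z) z) (hg' : ∀ z, HasDerivAt g' (g'' z) z) {σc R c₂ : ℝ}
    (hlo : ∀ z ∈ Icc (σc - R) (σc + R), c₂ ≤ g'' z) (hcrit : g' σc = 0) {σ : ℝ} (hσ : σ ∈ Icc (σc - R) (σc + R)) :
    g σc + c₂ / 2 * (σ - σc) ^ 2 ≤ g σ := by
  -- second-order lower bound along the segment from `σ_c` (re-derived here; cf. Toolbox `quadratic_lower_right/left`)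
  rcases le_total σc σ with hle | hle
  · have step1 : ∀ z ∈ Icc σc σ, c₂ * (z - σc) ≤ g' z := by
      intro z hz
      have := slope_growth_right hg' (x := σc) (y := σc + R) (fun u hu => hlo u ⟨by linarith [hu.1, hσ.1, hσ.2], hu.2⟩) ⟨hz.1, hz.2.trans hσ.2⟩
      rw [hcrit, sub_zero] at this; exact this
    have hφ' : ∀ t, HasDerivAt (fun t => g t - c₂ / 2 * ((t - σc) * (t - σc))) (g' t - c₂ * (t - σc)) t := by
      intro t
      have h1 := (hg t).fun_sub ((((hasDerivAt_id' t).sub_const σc).fun_mul ((hasDerivAt_id' t).sub_const σc)).const_mul (c₂ / 2))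
      exact h1.congr_deriv (by ring)
    have hmono := (convex_Icc σc σ).mul_sub_le_image_sub_of_le_deriv
      (f := fun t => g t - c₂ / 2 * ((t - σc) * (t - σc))) (C := 0)
      (fun t _ => (hφ' t).continuousAt.continuousWithinAt)
      (fun t _ => (hφ' t).differentiableAt.differentiableWithinAt)
      (fun t ht => by rw [(hφ' t).deriv]; have := step1 t (interior_subset ht); linarith)
      σc (left_mem_Icc.2 hle) σ (right_mem_Icc.2 hle) hle
    simp only [zero_mul, sub_self, mul_zero, sub_zero] at hmono
    nlinarith [hmono]
  · have step1 : ∀ z ∈ Icc σ σc, g' z ≤ c₂ * (z - σc) := by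
      intro z hz
      have := slope_growth_left hg' (x := σc - R) (y := σc) (fun u hu => hlo u ⟨hu.1, by linarith [hu.2, hσ.1, hσ.2]⟩) ⟨hσ.1.trans hz.1, hz.2⟩
      rw [hcrit, zero_sub] at this; linarith
    have hφ' : ∀ t, HasDerivAt (fun t => -g t + c₂ / 2 * ((t - σc) * (t - σc))) (-g' t + c₂ * (t - σc)) t := by
      intro t
      have h1 := (hg t).fun_neg.fun_add ((((hasDerivAt_id' t).sub_const σc).fun_mul ((hasDerivAt_id' t).sub_const σc)).const_mul (c₂ / 2))
      exact h1.congr_deriv (by ring)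
    have hmono := (convex_Icc σ σc).mul_sub_le_image_sub_of_le_deriv
      (f := fun t => -g t + c₂ / 2 * ((t - σc) * (t - σc))) (C := 0)
      (fun t _ => (hφ' t).continuousAt.continuousWithinAt)
      (fun t _ => (hφ' t).differentiableAt.differentiableWithinAt)
      (fun t ht => by rw [(hφ' t).deriv]; have := step1 t (interior_subset ht); linarith)
      σ (left_mem_Icc.2 hle) σc (right_mem_Icc.2 hle) hle
    simp only [zero_mul, sub_self, mul_zero, add_zero] at hmono
    nlinarith [hmono]

end Literature.MathematicalPhysics.QuantumLattice.BandSectorCounting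

end
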